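import Literature.MathematicalPhysics.QuantumFieldTheory.Balaban1983to89.T4AvgDerivBound
import Literature.MathematicalPhysics.QuantumFieldTheory.Balaban1983to89.UnitaryModel
import Literature.Computability.QuantumComplexity.SolovayKitaev.Basic

/-!
# T4 (row O3c.E2, addendum α) — the trace-Lipschitz hypothesis `ReTrLip G 1` in the unitary model

Cell `pub-balaban`, sub-cell B07 (unit `b2b-balaban-b07-g5`, gen 5), row **T4-O3c.E2** of `t4/T4-DAG.md` v3.
This leaf module DISCHARGES, in the tree's concrete unitary model of the `GaugeGroup` interface
(`GaugeGroup.ofUnitaryRep`, `instGaugeGroupUnitaryGroup`, `instGaugeGroupSpecialUnitaryGroup` of `UnitaryModel`), the one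
model-specific analytic hypothesis of `T4AvgDerivBound.loopVarBound_of_stepContraction` /
`loopDerivBound_of_stepContraction` / `loopOscBound_of_stepContraction`, namely

  `ReTrLip G Lip := ∀ g h : G, |reTr g − reTr h| ≤ Lip · dist1 (g⁻¹ h)`,

with the constant `Lip = 1`, for every group `H` carrying its `GaugeGroup` structure through a unitary matrix representation
`ρ : H →* M_n(ℂ)` (`dist1 h = ‖ρ h − 1‖_{op}`, `reTr h = Re tr ρ(h) / n`), in particular for `U(n)` and `SU(n)`.

WHAT IS PROVED (Mathlib-elementary; nothing printed by Bałaban is asserted, no hypothesis is a quotation):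
* (reused from the tree: `SolovayKitaev.norm_apply_le_norm` — an entry of a complex matrix is bounded by its
  `ℓ²`-operator norm;)
* `abs_nReTr_sub_le` — `|Re tr A / n − Re tr B / n| ≤ ‖A − B‖_{op}`;
* `norm_sub_le_opDist1_of_unitary` — for unitary `U`, `‖U − V‖ ≤ ‖Uᴴ V − 1‖` (in fact equality; the inequality suffices);
* `reTrLip_ofUnitaryRep` — `ReTrLip H 1` for the `GaugeGroup` structure `GaugeGroup.ofUnitaryRep H ρ hρ`;
* `reTrLip_unitaryGroup`, `reTrLip_specialUnitaryGroup` — the instances `U(n)`, `SU(n)`;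
* `loopVarBound_of_stepContraction_specialUnitary` — the E2 kernel theorem over `SU(n)` with `hLip` discharged
  (`Lip = 1`), as a usage certificate.

v1.1 (append-only §3): NON-VACUITY of `T4AvgDerivBound.GaugeStable` for the PRINTED domain type — plaquette
small-field domains ([Balaban1985Averaging] (52) "|U(∂p) − 1| < α₀η²", `Setup.PlaqSmall` / `PlaqSmallOn`) are gauge
stable (`plaqHol_gaugeAct` = (8) telescoped around (9), `plaqSmall_gaugeAct_iff`, `plaqSmallOn_gaugeAct_iff`,
`gaugeStable_plaqSmall`, `gaugeStable_plaqSmallOn`), hence over `SU(n)` on such domains the total-variation route needs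
ONLY `DomStable` + `AvgStepContraction` (`loopVarBound_of_stepContraction_plaqSmall_specialUnitary`).

WHAT IT DOES NOT GIVE: the two remaining hypothesis SHAPES of the E2 theorem — `DomStable` (domain propagation; the
printed statement of this KIND is [Balaban1985Averaging] Prop. 2 p.26 (54), whose constants are the instantiation's
business) and `AvgStepContraction` (NE1a-STEP, NOT PRINTED as typed: the located gap G-b07g5-2) — untouched here.

References (context only): [Balaban1985Averaging] (19) p.21 (the invariant metric `|U − 1|` on `G ⊂ U(N)`);
[BrockerTomDieck1985] I (1.9)–(1.10) (`U(n)`, `SU(n)` as compact Lie groups).  value = discharge of a typed hypothesis in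
the concrete model, NOT summit progress.
-/

open scoped BigOperators Matrix Matrix.Norms.L2Operator

namespace Literature.MathematicalPhysics.QuantumFieldTheory.Balaban1983to89.T4ReTrLipUnitary

open Literature.MathematicalPhysics.QuantumFieldTheory.Balaban1983to89
open Literature.MathematicalPhysics.QuantumFieldTheory.Balaban1983to89.T4AvgDerivBound
open Literature.MathematicalPhysics.QuantumFieldTheory.Balaban1983to89.UnitaryModel
open Literature.Computability.QuantumComplexity.SolovayKitaev (norm_apply_le_norm)

section MatrixLemmas

variable {n : Type*} [Fintype n] [DecidableEq n]

/-- The normalized real trace is `1`-Lipschitz for the operator norm: `|Re tr A / n − Re tr B / n| ≤ ‖A − B‖`. [folklore] -/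
theorem abs_nReTr_sub_le (A B : Matrix n n ℂ) : |nReTr A - nReTr B| ≤ ‖A - B‖ := by
  unfold nReTr
  rcases isEmpty_or_nonempty n with hn | hn
  · simp [Fintype.card_eq_zero]
  have hc : (0 : ℝ) < Fintype.card n := Nat.cast_pos.mpr Fintype.card_pos
  rw [← sub_div, ← Complex.sub_re, ← Matrix.trace_sub, abs_div, abs_of_pos hc, div_le_iff₀ hc]
  calc |(Matrix.trace (A - B)).re| ≤ ‖Matrix.trace (A - B)‖ := Complex.abs_re_le_norm _
    _ = ‖∑ i, (A - B) i i‖ := by simp [Matrix.trace]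
    _ ≤ ∑ i, ‖(A - B) i i‖ := norm_sum_le _ _
    _ ≤ ∑ _i : n, ‖A - B‖ := Finset.sum_le_sum fun i _ => norm_apply_le_norm _ i i
    _ = ‖A - B‖ * Fintype.card n := by simp [mul_comm]

/-- For a unitary `U` (and `n` nonempty): `‖U − V‖ ≤ ‖Uᴴ V − 1‖`, since `U − V = −U (Uᴴ V − 1)` and `‖U‖ = 1`. [folklore] -/
theorem norm_sub_le_opDist1_of_unitary [Nonempty n] {U : Matrix n n ℂ} (hU : U ∈ Matrix.unitaryGroup n ℂ)
    (V : Matrix n n ℂ) : ‖U - V‖ ≤ opDist1 (Uᴴ * V) := by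
  have hUU : U * Uᴴ = 1 := Unitary.mul_star_self_of_mem hU
  have e : U - V = -(U * (Uᴴ * V - 1)) := by
    rw [Matrix.mul_sub, ← Matrix.mul_assoc, hUU, Matrix.one_mul, mul_one, neg_sub]
  rw [e, norm_neg, opDist1]
  calc ‖U * (Uᴴ * V - 1)‖ ≤ ‖U‖ * ‖Uᴴ * V - 1‖ := Matrix.l2_opNorm_mul _ _
    _ = ‖Uᴴ * V - 1‖ := by rw [norm_of_mem_unitaryGroup hU, one_mul]

end MatrixLemmas

section Rep

variable {n : Type*} [Fintype n] [DecidableEq n] [Nonempty n] {H : Type*} [Group H]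
  (ρ : H →* Matrix n n ℂ) (hρ : ∀ h, ρ h ∈ Matrix.unitaryGroup n ℂ)

/-- **`ReTrLip H 1` in the unitary model.**  For the `GaugeGroup` structure induced by a unitary representation `ρ`
(`dist1 h = ‖ρ h − 1‖`, `reTr h = Re tr ρ(h)/n`): `|reTr g − reTr h| ≤ dist1 (g⁻¹ h)`, because
`|Re tr ρg/n − Re tr ρh/n| ≤ ‖ρg − ρh‖ ≤ ‖(ρg)ᴴ ρh − 1‖ = ‖ρ(g⁻¹h) − 1‖`. [folklore] -/
theorem reTrLip_ofUnitaryRep : @ReTrLip H (GaugeGroup.ofUnitaryRep H ρ hρ) 1 := by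
  intro g h
  show |nReTr (ρ g) - nReTr (ρ h)| ≤ 1 * opDist1 (ρ (g⁻¹ * h))
  rw [one_mul, map_mul, map_inv_eq_conjTranspose ρ hρ]
  exact (abs_nReTr_sub_le _ _).trans (norm_sub_le_opDist1_of_unitary (hρ g) _)

end Rep

section Instances

open Literature.MathematicalPhysics.QuantumLattice

variable {n : Type*} [DecidableEq n] [Fintype n] [Nonempty n]

/-- `ReTrLip (U(n)) 1` for the tree's instance `instGaugeGroupUnitaryGroup`. [folklore] -/
theorem reTrLip_unitaryGroup : ReTrLip (Matrix.unitaryGroup n ℂ) 1 :=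
  reTrLip_ofUnitaryRep (unitaryFundamentalRep n ℂ) fun U => U.2

/-- `ReTrLip (SU(n)) 1` for the tree's instance `instGaugeGroupSpecialUnitaryGroup`. [folklore] -/
theorem reTrLip_specialUnitaryGroup : ReTrLip (Matrix.specialUnitaryGroup n ℂ) 1 :=
  reTrLip_ofUnitaryRep (fundamentalRep n) fundamentalRep_mem_unitaryGroup

end Instances

section Usage

variable {P : Params} {n : Type*} [DecidableEq n] [Fintype n] [Nonempty n]

/-- USAGE CERTIFICATE: the E2 kernel theorem `loopVarBound_of_stepContraction` for `G = SU(n)` with the trace-Lipschitz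
hypothesis discharged (`Lip = 1`): the remaining hypotheses are exactly the three SHAPES `DomStable`, `GaugeStable`,
`AvgStepContraction` (located gap G-b07g5-2) and `0 ≤ θ`. [folklore] -/
theorem loopVarBound_of_stepContraction_specialUnitary
    (av : (j : ℕ) → Averaging P j (Matrix.specialUnitaryGroup n ℂ))
    (dom : (j : ℕ) → Set (GaugeField P j (Matrix.specialUnitaryGroup n ℂ))) {θ : ℝ}
    (hdom : DomStable av dom) (hg : GaugeStable dom) (hstep : AvgStepContraction av dom θ) (hθ : 0 ≤ θ) :
    LoopVarBound av dom 1 θ :=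
  loopVarBound_of_stepContraction (reTrLip_specialUnitaryGroup) zero_le_one hdom hg hstep hθ

end Usage

/-! ## §3 (v1.1) Non-vacuity of `GaugeStable` for PLAQUETTE-DEFINED domains, and the total-variation route over
`SU(n)` on Bałaban's small-field domains with only `DomStable` + `AvgStepContraction` left as hypotheses -/

section PlaqDomains

variable {P : Params} {G : Type*} [GaugeGroup G]

/-- GAUGE COVARIANCE OF PLAQUETTE VARIABLES: `U^u(∂p) = u(x) U(∂p) u(x)⁻¹` for the plaquette `p` at `x`
([Balaban1985Averaging] (8)–(9): the four factors telescope). [cite: Balaban1985Averaging, (9) p.19] -/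
theorem plaqHol_gaugeAct {j : ℕ} (u : GaugeTransf P j G) (U : GaugeField P j G) (p : Plaq P j) :
    GaugeField.plaqHol (GaugeField.gaugeAct u U) p = u p.src * GaugeField.plaqHol U p * (u p.src)⁻¹ := by
  simp only [GaugeField.plaqHol, GaugeField.gaugeAct, PBond.tgt, Site.shift_comm p.src p.ν p.μ]
  group

/-- The plaquette small-field condition `|U(∂p) − 1| < δ` ([Balaban1985Averaging] (52), `Setup.PlaqSmall`) is GAUGE
INVARIANT (`dist1 (h g h⁻¹) = dist1 g`). [cite: Balaban1985Averaging, (52) p.26] -/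
theorem plaqSmall_gaugeAct_iff {j : ℕ} (δ : ℝ) (u : GaugeTransf P j G) (U : GaugeField P j G) :
    PlaqSmall δ (GaugeField.gaugeAct u U) ↔ PlaqSmall δ U := by
  simp only [PlaqSmall, plaqHol_gaugeAct, GaugeGroup.dist1_conj]

/-- The same for the condition restricted to a set of plaquettes (`Setup.PlaqSmallOn`, [Balaban1988Convergent] (1.4)).
[cite: Balaban1988Convergent, (1.4) p.247] -/
theorem plaqSmallOn_gaugeAct_iff {j : ℕ} (S : Set (Plaq P j)) (δ : ℝ) (u : GaugeTransf P j G) (U : GaugeField P j G) :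
    PlaqSmallOn S δ (GaugeField.gaugeAct u U) ↔ PlaqSmallOn S δ U := by
  simp only [PlaqSmallOn, plaqHol_gaugeAct, GaugeGroup.dist1_conj]

/-- NON-VACUITY of the hypothesis shape `T4AvgDerivBound.GaugeStable` for THE PRINTED DOMAIN TYPE: the family of
plaquette small-field domains `{V | |V(∂p) − 1| < δ_j ∀ p}` ([Balaban1985Averaging] (52) with any thresholds `δ_j`) is
gauge stable. [cite: Balaban1985Averaging, (52) p.26] -/
theorem gaugeStable_plaqSmall (δ : ℕ → ℝ) :
    GaugeStable (P := P) (fun j => {V : GaugeField P j G | PlaqSmall (δ j) V}) :=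
  fun j u V hV => (plaqSmall_gaugeAct_iff (δ j) u V).mpr hV

/-- The same for plaquette conditions on prescribed sets of plaquettes `S j` (large/small-field regions). [cite: Balaban1988Convergent, (1.4) p.247] -/
theorem gaugeStable_plaqSmallOn (S : ∀ j, Set (Plaq P j)) (δ : ℕ → ℝ) :
    GaugeStable (P := P) (fun j => {V : GaugeField P j G | PlaqSmallOn (S j) (δ j) V}) :=
  fun j u V hV => (plaqSmallOn_gaugeAct_iff (S j) (δ j) u V).mpr hV

end PlaqDomains

section PlaqDomainsUnitary

variable {P : Params} {n : Type*} [Fintype n] [DecidableEq n] [Nonempty n]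

/-- THE TOTAL-VARIATION ROUTE OVER `SU(n)` ON BAŁABAN'S PLAQUETTE SMALL-FIELD DOMAINS: with `ReTrLip` discharged (§2,
`Lip = 1`) and `GaugeStable` discharged (§3, `gaugeStable_plaqSmall`), the loop total-variation bound
`LoopVarBound av dom 1 θ` at every step count follows from the two remaining hypotheses ONLY — `DomStable av dom`
(domain propagation: the printed statement of this KIND is [Balaban1985Averaging] Prop. 2 p.26 (54), constants being the
instantiation's business) and the one-step contraction NE1a-STEP `AvgStepContraction av dom θ` (NOT PRINTED as typed).
[cite: Balaban1985Averaging, (52) p.26] -/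
theorem loopVarBound_of_stepContraction_plaqSmall_specialUnitary
    (av : ∀ j, Averaging P j (Matrix.specialUnitaryGroup n ℂ)) (δ : ℕ → ℝ) {θ : ℝ}
    (hdom : DomStable av (fun j => {V | PlaqSmall (δ j) V}))
    (hstep : AvgStepContraction av (fun j => {V | PlaqSmall (δ j) V}) θ) (hθ : 0 ≤ θ) :
    LoopVarBound av (fun j => {V | PlaqSmall (δ j) V}) 1 θ :=
  loopVarBound_of_stepContraction_specialUnitary av _ hdom (gaugeStable_plaqSmall δ) hstep hθ

end PlaqDomainsUnitary

end Literature.MathematicalPhysics.QuantumFieldTheory.Balaban1983to89.T4ReTrLipUnitary
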